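import Summits.KontsevichZagierPeriods.KontsevichZagierPeriods.Theorems.KzOnePeriodsE1XiLoops

/-!
# KZ 1-periods (kz1p): third kind at infinity on genus 2 — the Pell unit `u = P + Q·y` (shape (U))

Helper file of the `kz1p` support package (explicit unit `b2b-kz1p`, helper lane; it supports the audited
statement item of `KzOnePeriods` without closing it).

On the affine plane model `C = C_{a,b,c} : y² = f(x) = x⁶ + a x⁴ + b x² + c` (tree `Cpl[a, b, c]`,
`KzOnePeriodsG2SPlane.lean`) a form `p(x) dx/(2y)` with `deg p = 2` is of the THIRD KIND: its residue divisor is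
supported at the two points `∞±` at infinity (kz1p PROCEDURE §8.9), out of reach of the quotient maps `φ₁, φ₂`.
When `ℚ̄[C]` has a unit `u = P(x) + Q(x)·y` with `P² − Q² f = 1` (a solution of the polynomial PELL EQUATION of
`f`; `div u = m·(∞−) − m·(∞+)`), its logarithmic differential is such a form:
`du/u = ū du = (P − Q y)(P′ dx + Q′ y dx + Q dy) ≡ p dx/(2y)` on `C` with
`p = 2(P Q′ − P′ Q) f + P Q f′` (using `2 P P′ − 2 Q Q′ f − Q² f′ = (P² − Q² f)′ = 0`).  This file proves,
for coefficient vectors `e, d, π` of `P, Q, p` satisfying those three scalar identities (decided by `ring` in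
the generated per-case files):

* `pell_mem` — `(u, ū) = (P + Q y, P − Q y)` maps `C` to `𝔾ₘ = {u ū = 1}`; `exists_pellPath` — the image
  `(u, ū)∘γ` of a `C¹` path on `C` with algebraic end points is such a path on `𝔾ₘ`;
* `vanishes_pell` — `(u, ū)^*(v du) − θ_p` VANISHES on `C` ((R2); two `linear_combination` certificates: at
  `y ≠ 0` after multiplication by `2y`, at the branch points `y = 0` after multiplication by `f′(x) ≠ 0`);
* `span_pell` / `relation_pell` — hence `(C, θ_p, γ) − (𝔾ₘ, v du, (u, ū)∘γ) ∈ ⟨(R1)–(R5)⟩_ℚ̄` ((R4) along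
  `(u, ū)`, (R2), (R1)) and `∫_γ p dx/(2y) = ∫_{u∘γ} du/u`: the third-kind period IS a logarithm symbol, whose
  value over kz1p's closed ovals is `2πi·w` with the winding number `w` of `u∘γ` (`KzOnePeriodsGmWinding.lean`).

[cite: HuberWustholz2022, §13.1 (A)–(B) (p. 120), Thm 13.3 (2) (p. 121), §10.1 (p. 96)]

No new axioms; no statements of the programme are cited.
-/

noncomputable section

open scoped BigOperators
open MvPolynomial Set Complex Filter Topology
open Literature.NumberTheory.Transcendental Literature.NumberTheory.Transcendental.CurvePeriods
open Summit.KontsevichZagierPeriods.KzOnePeriods.E1Derivation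

namespace Summit.KontsevichZagierPeriods.KzOnePeriods.G2SDerivation

local notation3 "InSpanRel " c:arg => ∃ (k : ℕ) (ρ : Fin k → (PeriodSymbol →₀ ℂ))
  (a : Fin k → ℂ), (∀ l, IsElementaryRelation (ρ l)) ∧ (∀ l, IsAlgebraic ℚ (a l)) ∧
    c = ∑ l, a l • ρ l

/-- The symbol `(Z, ω, γ)` as an element of the formal period space. -/
local notation3 (prettyPrint := false) "Sy[" Z ", " hZ ", " ω ", " h ", " γ "]" =>
  (Finsupp.single (⟨Z, hZ, ω, h, γ⟩ : PeriodSymbol) (1 : ℂ) : PeriodSymbol →₀ ℂ)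

/-- The period `∫_γ ω` of the symbol `(Z, ω, γ)`. -/
local notation3 (prettyPrint := false) "Pe[" Z ", " hZ ", " ω ", " h ", " γ "]" =>
  PeriodSymbol.period (⟨Z, hZ, ω, h, γ⟩ : PeriodSymbol)

/-- The even sextic `f = x⁶ + a x⁴ + b x² + c ∈ ℂ[x, y]`. -/
local notation3 (prettyPrint := false) "fS[" a ", " b ", " c "]" =>
  ((X 0 : MvPolynomial (Fin 2) ℂ) ^ 6 + C a * X 0 ^ 4 + C b * X 0 ^ 2 + C c)

/-- The affine plane model `C_{a,b,c} = {y² = f(x)} ⊂ 𝔸²` of the genus-2 curve (minus `∞±`). -/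
local notation3 (prettyPrint := false) "Cpl[" a ", " b ", " c "]" =>
  (⟨2, 1, ![(X 1 : MvPolynomial (Fin 2) ℂ) ^ 2 - fS[a, b, c]]⟩ : CurveData)

/-- The polynomial `Σ_k π_k x^k ∈ ℂ[x, y]` with coefficient vector `π`. -/
local notation3 (prettyPrint := false) "Pol[" π "]" =>
  (∑ k, C (π k) * (X 0 : MvPolynomial (Fin 2) ℂ) ^ (k : ℕ))

/-- The even polynomial `U = Σ_{k<3} μ_k x^{2k}` (Bézout cofactor of `f`). -/
local notation3 (prettyPrint := false) "Upol[" μ "]" =>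
  (∑ k : Fin 3, C (μ k) * (X 0 : MvPolynomial (Fin 2) ℂ) ^ (2 * (k : ℕ)))

/-- The odd polynomial `V = Σ_{k<3} ν_k x^{2k+1}` (Bézout cofactor of `f′`). -/
local notation3 (prettyPrint := false) "Vpol[" ν "]" =>
  (∑ k : Fin 3, C (ν k) * (X 0 : MvPolynomial (Fin 2) ℂ) ^ (2 * (k : ℕ) + 1))

/-- `θ[μ, ν, π] = (½ P U y) dx + (P V) dy`, the polynomial representative of `P(x) dx/(2y)`. -/
local notation3 (prettyPrint := false) "θ[" μ ", " ν ", " π "]" =>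
  (![C (1 / 2 : ℂ) * Pol[π] * Upol[μ] * X 1, Pol[π] * Vpol[ν]] :
    Fin 2 → MvPolynomial (Fin 2) ℂ)

/-- The Bézout identity `U f + V f′ = 1` (scalar form). -/
local notation3 (prettyPrint := false) "Bez[" a ", " b ", " c ", " μ ", " ν "]" =>
  (∀ x : ℂ, (∑ k : Fin 3, μ k * x ^ (2 * (k : ℕ))) * (x ^ 6 + a * x ^ 4 + b * x ^ 2 + c) +
    (∑ k : Fin 3, ν k * x ^ (2 * (k : ℕ) + 1)) * (6 * x ^ 5 + 4 * a * x ^ 3 + 2 * b * x) = 1)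

/-- The multiplicative group `𝔾ₘ = {uv = 1} ⊂ 𝔸²`. -/
local notation3 (prettyPrint := false) "𝔾m" => (⟨2, 1, ![X 0 * X 1 - 1]⟩ : CurveData)

/-- The logarithm symbol `(𝔾ₘ, v du, E)` over a path `E` on `𝔾ₘ`. -/
local notation3 "logSym " E:arg => (⟨⟨2, 1, ![X 0 * X 1 - 1]⟩, isSmoothAffineCurve_mulGroup,
  ![X 1, 0], hasAlgCoeffs_ydx, E⟩ : PeriodSymbol)

/-- **The Pell unit map** `(u, ū) = (P + Q y, P − Q y) : C_{a,b,c} → 𝔸²`, `P = Pol[e]`, `Q = Pol[d]`. -/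
local notation3 (prettyPrint := false) "pell[" e ", " d "]" =>
  (![Pol[e] + Pol[d] * X 1, Pol[e] - Pol[d] * X 1] : Fin 2 → MvPolynomial (Fin 2) ℂ)

/-- The Pell equation `P² − Q² f = 1` (scalar form): `u ū = 1`. -/
local notation3 (prettyPrint := false) "Pell[" a ", " b ", " c ", " e ", " d "]" =>
  (∀ x : ℂ, (∑ k, e k * x ^ (k : ℕ)) ^ 2 -
    (∑ k, d k * x ^ (k : ℕ)) ^ 2 * (x ^ 6 + a * x ^ 4 + b * x ^ 2 + c) = 1)

/-- Its derivative `2 P P′ − 2 Q Q′ f − Q² f′ = 0` (scalar form). -/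
local notation3 (prettyPrint := false) "PellD[" a ", " b ", " c ", " e ", " d "]" =>
  (∀ x : ℂ, 2 * (∑ k, e k * x ^ (k : ℕ)) * (∑ k, e k * ((k : ℕ) : ℂ) * x ^ ((k : ℕ) - 1)) -
    2 * (∑ k, d k * x ^ (k : ℕ)) * (∑ k, d k * ((k : ℕ) : ℂ) * x ^ ((k : ℕ) - 1)) *
      (x ^ 6 + a * x ^ 4 + b * x ^ 2 + c) -
    (∑ k, d k * x ^ (k : ℕ)) ^ 2 * (6 * x ^ 5 + 4 * a * x ^ 3 + 2 * b * x) = 0)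

/-- `p = 2(P Q′ − P′ Q) f + P Q f′` (scalar form): `du/u ≡ p dx/(2y)` on `C`. -/
local notation3 (prettyPrint := false) "LogD[" a ", " b ", " c ", " e ", " d ", " π "]" =>
  (∀ x : ℂ, ∑ k, π k * x ^ (k : ℕ) =
    2 * ((∑ k, e k * x ^ (k : ℕ)) * (∑ k, d k * ((k : ℕ) : ℂ) * x ^ ((k : ℕ) - 1)) -
      (∑ k, e k * ((k : ℕ) : ℂ) * x ^ ((k : ℕ) - 1)) * (∑ k, d k * x ^ (k : ℕ))) *
      (x ^ 6 + a * x ^ 4 + b * x ^ 2 + c) +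
    (∑ k, e k * x ^ (k : ℕ)) * (∑ k, d k * x ^ (k : ℕ)) * (6 * x ^ 5 + 4 * a * x ^ 3 + 2 * b * x))

variable {a b c : ℂ}

/-! ### The map `(u, ū)` -/

/-- `(u, ū)` is defined over `ℚ̄` when `P, Q ∈ ℚ̄[x]`. -/
theorem hasAlgCoeffs_pell {N M : ℕ} {e : Fin N → ℂ} {d : Fin M → ℂ} (he : ∀ k, IsAlgebraic ℚ (e k))
    (hd : ∀ k, IsAlgebraic ℚ (d k)) : ∀ j, HasAlgCoeffs ((pell[e, d]) j) := fun j => by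
  fin_cases j
  · simpa using (hasAlgCoeffs_Pol he).add ((hasAlgCoeffs_Pol hd).mul (hasAlgCoeffs_X (n := 2) 1))
  · simpa using (hasAlgCoeffs_Pol he).sub ((hasAlgCoeffs_Pol hd).mul (hasAlgCoeffs_X (n := 2) 1))

/-- `(u, ū)(z) = (P(z₀) + Q(z₀) z₁, P(z₀) − Q(z₀) z₁)`. -/
theorem eval_pell {N M : ℕ} (e : Fin N → ℂ) (d : Fin M → ℂ) (z : Fin 2 → ℂ) :
    (fun j => eval z ((pell[e, d]) j)) =
      ![(∑ k, e k * z 0 ^ (k : ℕ)) + (∑ k, d k * z 0 ^ (k : ℕ)) * z 1,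
        (∑ k, e k * z 0 ^ (k : ℕ)) - (∑ k, d k * z 0 ^ (k : ℕ)) * z 1] := by
  funext j
  fin_cases j
  · simp [map_sum]
  · simp [map_sum]

/-- The Jacobian of `(u, ū)`: `∂u/∂x = P′ + Q′ z₁`, `∂u/∂y = Q`, `∂ū/∂x = P′ − Q′ z₁`, `∂ū/∂y = −Q`. -/
theorem eval_pderiv_pell {N M : ℕ} (e : Fin N → ℂ) (d : Fin M → ℂ) (z : Fin 2 → ℂ) :
    (eval z (pderiv 0 ((pell[e, d]) 0)) =
        (∑ k, e k * ((k : ℕ) : ℂ) * z 0 ^ ((k : ℕ) - 1)) +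
          (∑ k, d k * ((k : ℕ) : ℂ) * z 0 ^ ((k : ℕ) - 1)) * z 1 ∧
      eval z (pderiv 1 ((pell[e, d]) 0)) = ∑ k, d k * z 0 ^ (k : ℕ)) ∧
      eval z (pderiv 0 ((pell[e, d]) 1)) =
        (∑ k, e k * ((k : ℕ) : ℂ) * z 0 ^ ((k : ℕ) - 1)) -
          (∑ k, d k * ((k : ℕ) : ℂ) * z 0 ^ ((k : ℕ) - 1)) * z 1 ∧
      eval z (pderiv 1 ((pell[e, d]) 1)) = -(∑ k, d k * z 0 ^ (k : ℕ)) := by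
  have h10 : (1 : Fin 2) ≠ 0 := by decide
  have e0 : (pell[e, d]) 0 = Pol[e] + Pol[d] * X 1 := rfl
  have e1 : (pell[e, d]) 1 = Pol[e] - Pol[d] * X 1 := rfl
  refine ⟨⟨?_, ?_⟩, ?_, ?_⟩
  · rw [e0, map_add, pderiv_mul, pderiv_X_of_ne h10, mul_zero, add_zero, map_add, map_mul, eval_X,
      eval_pderiv_zero_Pol, eval_pderiv_zero_Pol]
  · rw [e0, map_add, pderiv_mul, pderiv_X_self, pderiv_one_Pol, pderiv_one_Pol, zero_mul, zero_add,
      zero_add, mul_one, eval_Pol]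
  · rw [e1, map_sub, pderiv_mul, pderiv_X_of_ne h10, mul_zero, add_zero, map_sub, map_mul, eval_X,
      eval_pderiv_zero_Pol, eval_pderiv_zero_Pol]
  · rw [e1, map_sub, pderiv_mul, pderiv_X_self, pderiv_one_Pol, pderiv_one_Pol, zero_mul, zero_add,
      zero_sub, mul_one, map_neg, eval_Pol]

/-- The chain rule for `(u, ū)` and `v du`: `((u, ū)^*(v du))(z)(v) = ū(z)·(u_x(z) v₀ + u_y(z) v₁)`. -/
theorem pell_pair {N M : ℕ} (e : Fin N → ℂ) (d : Fin M → ℂ) (z v : Fin 2 → ℂ) :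
    ∑ i, eval z (formPullback (pell[e, d]) ![X 1, 0] i) * v i =
      ((∑ k, e k * z 0 ^ (k : ℕ)) - (∑ k, d k * z 0 ^ (k : ℕ)) * z 1) *
        (((∑ k, e k * ((k : ℕ) : ℂ) * z 0 ^ ((k : ℕ) - 1)) +
            (∑ k, d k * ((k : ℕ) : ℂ) * z 0 ^ ((k : ℕ) - 1)) * z 1) * v 0 +
          (∑ k, d k * z 0 ^ (k : ℕ)) * v 1) := by
  obtain ⟨⟨h00, h10⟩, h01, h11⟩ := eval_pderiv_pell e d z
  simp only [Fin.sum_univ_two, formPullback_two, map_add, map_mul, eval_bind₁_eq, h00, h10, h01, h11]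
  rw [eval_pell]
  simp only [Matrix.cons_val_zero, Matrix.cons_val_one, eval_X, map_zero, zero_mul, add_zero]
  ring

/-- **`(u, ū)` maps `C_{a,b,c}` into `𝔾ₘ`**: `u ū = P² − Q² y² = P² − Q² f = 1` on `C`. -/
theorem pell_mem {N M : ℕ} {e : Fin N → ℂ} {d : Fin M → ℂ} (hunit : Pell[a, b, c, e, d]) :
    ∀ z ∈ Cpl[a, b, c].points, (fun j => eval z ((pell[e, d]) j)) ∈ (𝔾m).points := by
  intro z hz
  rw [mem_points_iff] at hz
  rw [eval_pell, mem_points_mulGroup_iff]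
  simp only [Matrix.cons_val_zero, Matrix.cons_val_one]
  have hU := hunit (z 0)
  linear_combination hU - (∑ k, d k * z 0 ^ (k : ℕ)) ^ 2 * hz

/-- **The image path** `(u, ū)∘γ` is a `C¹` path on `𝔾ₘ` with algebraic end points, for every `C¹` path `γ`
on `C_{a,b,c}` with algebraic end points. -/
theorem exists_pellPath {N M : ℕ} {e : Fin N → ℂ} {d : Fin M → ℂ} (he : ∀ k, IsAlgebraic ℚ (e k))
    (hd : ∀ k, IsAlgebraic ℚ (d k)) (hunit : Pell[a, b, c, e, d]) (γ : CurvePath Cpl[a, b, c]) :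
    ∃ γ' : CurvePath 𝔾m, ∀ t, γ'.toFun t =
      ![(∑ k, e k * γ.toFun t 0 ^ (k : ℕ)) + (∑ k, d k * γ.toFun t 0 ^ (k : ℕ)) * γ.toFun t 1,
        (∑ k, e k * γ.toFun t 0 ^ (k : ℕ)) - (∑ k, d k * γ.toFun t 0 ^ (k : ℕ)) * γ.toFun t 1] :=
  (exists_imagePath (Z := Cpl[a, b, c]) (Z' := 𝔾m) (pell[e, d]) (hasAlgCoeffs_pell he hd)
    (pell_mem hunit) γ).imp fun _ h t => (h t).trans (eval_pell e d _)

/-! ### `(u, ū)^*(v du) ≡ p dx/(2y)` on `C_{a,b,c}` -/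

/-- **`du/u ≡ p dx/(2y)` on `C`.**  With (the derivative of the Pell equation) `2PP′ − 2QQ′f − Q²f′ = 0`,
`p = 2(PQ′ − P′Q) f + PQ f′` and a Bézout pair `U f + V f′ = 1`, the polynomial form
`(u, ū)^*(v du) − θ_p = ū·(u_x dx + u_y dy) − ((½ p U y) dx + (p V) dy)` vanishes on every tangent line of
`C_{a,b,c}`: at the points `y ≠ 0` both restrict to `p dx/(2y)` (`2y·ū·u_x + ū Q f′ = p + y·(P² − Q²f)′ = p`
modulo `y² = f`); at the branch points `y = 0` the tangent line is `dx = 0` (`f′(x) ≠ 0` by Bézout) and the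
`dy`-coefficients agree: `ū u_y = P Q = P Q f′ V = p V` (`V f′ = 1`, `p = P Q f′` at a root of `f`). -/
theorem vanishes_pell {μ ν : Fin 3 → ℂ} (hbez : Bez[a, b, c, μ, ν]) {N M L : ℕ} {e : Fin N → ℂ}
    {d : Fin M → ℂ} {π : Fin L → ℂ} (hunitD : PellD[a, b, c, e, d]) (hp : LogD[a, b, c, e, d, π]) :
    VanishesOn Cpl[a, b, c] (formPullback (pell[e, d]) ![X 1, 0] - (1 : ℂ) • θ[μ, ν, π]) := by
  intro z hz v hv
  rw [mem_points_iff] at hz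
  rw [mem_tangentSpace_iff] at hv
  have hB := hbez (z 0)
  have hD := hunitD (z 0)
  have hP := hp (z 0)
  have cancel : ∀ {q w : ℂ}, q ≠ 0 → q * w = 0 → w = 0 := fun hq h =>
    (mul_eq_zero.1 h).resolve_left hq
  have hsplit : ∑ i, eval z ((formPullback (pell[e, d]) ![X 1, 0] - (1 : ℂ) • θ[μ, ν, π]) i) * v i =
      (∑ i, eval z (formPullback (pell[e, d]) ![X 1, 0] i) * v i) -
        (eval z (θ[μ, ν, π] 0) * v 0 + eval z (θ[μ, ν, π] 1) * v 1) := by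
    simp only [Fin.sum_univ_two, Pi.sub_apply, Pi.smul_apply, map_sub, smul_eval, one_mul]
    ring
  rw [hsplit, pell_pair]
  simp only [Matrix.cons_val_zero, Matrix.cons_val_one, map_mul, eval_C, eval_X, eval_Pol, eval_Upol,
    eval_Vpol]
  set P := ∑ k, e k * z 0 ^ (k : ℕ) with hPdef
  set P' := ∑ k, e k * ((k : ℕ) : ℂ) * z 0 ^ ((k : ℕ) - 1) with hP'def
  set Q := ∑ k, d k * z 0 ^ (k : ℕ) with hQdef
  set Q' := ∑ k, d k * ((k : ℕ) : ℂ) * z 0 ^ ((k : ℕ) - 1) with hQ'def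
  set R := ∑ k, π k * z 0 ^ (k : ℕ) with hRdef
  set U := ∑ k : Fin 3, μ k * z 0 ^ (2 * (k : ℕ)) with hU
  set V := ∑ k : Fin 3, ν k * z 0 ^ (2 * (k : ℕ) + 1) with hV
  by_cases hy : z 1 = 0
  · -- branch point: `f(z₀) = 0`, `V f′ = 1`, `f′(z₀) ≠ 0`, so `v₀ = 0`
    have hf0 : z 0 ^ 6 + a * z 0 ^ 4 + b * z 0 ^ 2 + c = 0 := by
      linear_combination -hz + z 1 * hy
    have hVf : V * (6 * z 0 ^ 5 + 4 * a * z 0 ^ 3 + 2 * b * z 0) = 1 := by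
      linear_combination hB - U * hf0
    have hf' : (6 * z 0 ^ 5 + 4 * a * z 0 ^ 3 + 2 * b * z 0) ≠ 0 := fun h0 =>
      zero_ne_one (by linear_combination hVf - V * h0)
    refine cancel hf' ?_
    linear_combination (-(P * P')) * hv - ((R * U - 2 * (P * Q' - P' * Q)) * v 1) * hz -
      (R * v 1) * hB - v 1 * hP +
      (2 * v 1 * P * P' + z 1 * v 1 * (U * R + 2 * P' * Q - 2 * P * Q') -
        v 1 * Q ^ 2 * (6 * z 0 ^ 5 + 4 * a * z 0 ^ 3 + 2 * b * z 0) -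
        (1 / 2 : ℂ) * v 0 * (U * R + 2 * P' * Q - 2 * P * Q') * (6 * z 0 ^ 5 + 4 * a * z 0 ^ 3 + 2 * b * z 0) -
        z 1 * v 0 * Q * Q' * (6 * z 0 ^ 5 + 4 * a * z 0 ^ 3 + 2 * b * z 0)) * hy
  · refine cancel (mul_ne_zero two_ne_zero hy) ?_
    linear_combination ((P - Q * z 1) * Q - R * V) * hv +
      ((-(R * U) - 2 * z 1 * Q * Q' + 2 * (P * Q' - Q * P')) * v 0) * hz - (R * v 0) * hB +
      (z 1 * v 0) * hD - v 0 * hP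

/-! ### The derivation: `(C, θ_p, γ) ∼ (𝔾ₘ, v du, (u, ū)∘γ)` -/

/-- **Shape (U), third kind at infinity.**  For algebraic data as above and every `C¹` path `γ` on `C_{a,b,c}`
with algebraic end points, `γ′ = (u, ū)∘γ` on `[0, 1]`:
`(C, θ_p, γ) − (𝔾ₘ, v du, γ′) ∈ ⟨(R1)–(R5)⟩_ℚ̄` ((R4) along `(u, ū)`, (R2) for `(u, ū)^*(v du) − θ_p`, (R1)).
[cite: HuberWustholz2022, §13.1 (A)–(B) (p. 120)] -/
theorem span_pell (ha : IsAlgebraic ℚ a) (hb : IsAlgebraic ℚ b) (hc : IsAlgebraic ℚ c)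
    {μ ν : Fin 3 → ℂ} (hμ : ∀ k, IsAlgebraic ℚ (μ k)) (hν : ∀ k, IsAlgebraic ℚ (ν k))
    (hbez : Bez[a, b, c, μ, ν]) {N M L : ℕ} {e : Fin N → ℂ} {d : Fin M → ℂ} {π : Fin L → ℂ}
    (he : ∀ k, IsAlgebraic ℚ (e k)) (hd : ∀ k, IsAlgebraic ℚ (d k)) (hπ : ∀ k, IsAlgebraic ℚ (π k))
    (hunit : Pell[a, b, c, e, d]) (hunitD : PellD[a, b, c, e, d]) (hp : LogD[a, b, c, e, d, π])
    {γ : CurvePath Cpl[a, b, c]} {γ' : CurvePath 𝔾m}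
    (hγ' : ∀ t ∈ Icc (0 : ℝ) 1, γ'.toFun t =
      ![(∑ k, e k * γ.toFun t 0 ^ (k : ℕ)) + (∑ k, d k * γ.toFun t 0 ^ (k : ℕ)) * γ.toFun t 1,
        (∑ k, e k * γ.toFun t 0 ^ (k : ℕ)) - (∑ k, d k * γ.toFun t 0 ^ (k : ℕ)) * γ.toFun t 1]) :
    InSpanRel (Sy[Cpl[a, b, c], smooth ha hb hc hbez, θ[μ, ν, π], hasAlgCoeffs_theta hμ hν hπ, γ] -
      Finsupp.single (logSym γ') (1 : ℂ)) := by
  have hγ'' : ∀ t ∈ Icc (0 : ℝ) 1, γ'.toFun t = fun j => eval (γ.toFun t) ((pell[e, d]) j) :=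
    fun t ht => by rw [hγ' t ht, eval_pell]
  have h := span_image_of_formPullback_vanish (smooth ha hb hc hbez) isSmoothAffineCurve_mulGroup
    (pell[e, d]) (hasAlgCoeffs_pell he hd) (pell_mem hunit) ![X 1, 0] hasAlgCoeffs_ydx (θ[μ, ν, π])
    (hasAlgCoeffs_theta hμ hν hπ) isAlgebraic_one (vanishes_pell hbez hunitD hp) hγ''
  obtain ⟨k, ρ, w, hρ, hw, hs⟩ := span_smul (isAlgebraic_one.neg) h
  exact ⟨k, ρ, w, hρ, hw, by rw [← hs, one_smul, neg_one_smul, neg_sub]⟩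

/-- **`∫_γ p dx/(2y) = ∫_{(u,ū)∘γ} v du`** (soundness of (R1)–(R5), [HuberWustholz2022] Thm 13.3 (2)). -/
theorem relation_pell (ha : IsAlgebraic ℚ a) (hb : IsAlgebraic ℚ b) (hc : IsAlgebraic ℚ c)
    {μ ν : Fin 3 → ℂ} (hμ : ∀ k, IsAlgebraic ℚ (μ k)) (hν : ∀ k, IsAlgebraic ℚ (ν k))
    (hbez : Bez[a, b, c, μ, ν]) {N M L : ℕ} {e : Fin N → ℂ} {d : Fin M → ℂ} {π : Fin L → ℂ}
    (he : ∀ k, IsAlgebraic ℚ (e k)) (hd : ∀ k, IsAlgebraic ℚ (d k)) (hπ : ∀ k, IsAlgebraic ℚ (π k))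
    (hunit : Pell[a, b, c, e, d]) (hunitD : PellD[a, b, c, e, d]) (hp : LogD[a, b, c, e, d, π])
    {γ : CurvePath Cpl[a, b, c]} {γ' : CurvePath 𝔾m}
    (hγ' : ∀ t ∈ Icc (0 : ℝ) 1, γ'.toFun t =
      ![(∑ k, e k * γ.toFun t 0 ^ (k : ℕ)) + (∑ k, d k * γ.toFun t 0 ^ (k : ℕ)) * γ.toFun t 1,
        (∑ k, e k * γ.toFun t 0 ^ (k : ℕ)) - (∑ k, d k * γ.toFun t 0 ^ (k : ℕ)) * γ.toFun t 1]) :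
    Pe[Cpl[a, b, c], smooth ha hb hc hbez, θ[μ, ν, π], hasAlgCoeffs_theta hμ hν hπ, γ] =
      (logSym γ').period := by
  have hγ'' : ∀ t ∈ Icc (0 : ℝ) 1, γ'.toFun t = fun j => eval (γ.toFun t) ((pell[e, d]) j) :=
    fun t ht => by rw [hγ' t ht, eval_pell]
  have h := image_of_formPullback_vanish (smooth ha hb hc hbez) isSmoothAffineCurve_mulGroup
    (pell[e, d]) (hasAlgCoeffs_pell he hd) (pell_mem hunit) ![X 1, 0] hasAlgCoeffs_ydx (θ[μ, ν, π])
    (hasAlgCoeffs_theta hμ hν hπ) isAlgebraic_one (vanishes_pell hbez hunitD hp) hγ''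
  rw [h, one_mul]

end Summit.KontsevichZagierPeriods.KzOnePeriods.G2SDerivation

end
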